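import Mathlib
import Summits.ResolutionOfSingularities.ResolutionOfSingularities.Theorems.WildQuotientsWildQuotientResolutionToricChartFaceIdeal

/-!
# Toric chart certificates — the face ideal is the contraction of the variable ideal along `θ`

(crux stmt-ResolutionOfSingularities-15640 `WildQuotients.WildQuotientResolution`, line `Sketch`;
chain w45c RUNG V5, brick `HP₀` ring side `JordanFive.exists_ringBrick_X0_model` (res-L1-w45c-plan-1
ORDERS 2026-08-27T12:39:07Z; prover res-L1-w45c-stub-2): companion of res-L1-w45c-stub-4's
`ToricChart.isPrime_faceIdeal` (p531108). [OURS · L1 W4.5c] — generic, NOT a statement of any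
manuscript; replaces the role of no printed item. Def-free.)

For a cone datum `D : ConeDatum d r`, a set `Z` of distinguished coordinates with `hpw`/`hmix` as in
p531108, and the injective structure map `θ : A = ToricChart.Ring k P D → k[x_s, passengers]`:

* `theta_mem_span_X_of_mem_faceIdeal` — `θ (faceIdeal Z) ⊆ ⟨x_s : s ∈ Z⟩`;
* `faceSubst_eq_zero_of_mem_span_X` — the substitution `x_s ↦ 0 (s ∈ Z)` kills `⟨x_s : s ∈ Z⟩`;
* `faceSubst_presentation_rename_surv` — it fixes the presentation of every polynomial in the
  surviving symbols (pure symbols off `Z`, passengers);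
* `map_mk_span_X_compl_surv` — the classes of the non-surviving symbols generate `faceIdeal Z`;
* **`comap_theta_span_X_eq_faceIdeal`** — `θ⁻¹ ⟨x_s : s ∈ Z⟩ = faceIdeal Z`: the radical identities
  of the `HP₀` ring model contract `⟨x_a, x_b, x_d⟩` / `⟨x_a, x_b, x_c, x_d⟩` to the axis / vertex
  face ideals of `¼(1,1,2,3) × 𝔸^P`.
-/

-- single-problem summit: the doubled namespace component `ResolutionOfSingularities` is forced
set_option linter.dupNamespace false

noncomputable section

open MvPolynomial

namespace Summit.ResolutionOfSingularities.ResolutionOfSingularities.Theorems.WildQuotientResolution.ToricChart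

variable {d r : ℕ} (k : Type) [Field k] (P : Type) (D : ConeDatum d r) (Z : Finset (Fin d))

/-- A monomial `∏ x_s ^ e s` with `e i ≠ 0` for some `i ∈ Z` lies in `⟨x_s : s ∈ Z⟩`. [folklore] -/
theorem xmon_mem_span_X {e : Fin d → ℕ} {i : Fin d} (hi : i ∈ Z) (he : e i ≠ 0) :
    xmon k P e ∈ Ideal.span ((fun s => (X (Sum.inl s) : MvPolynomial (Fin d ⊕ P) k)) '' (Z : Set (Fin d))) := by
  rw [xmon, ← Finset.mul_prod_erase Finset.univ _ (Finset.mem_univ i)]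
  have hX : (X (Sum.inl i) : MvPolynomial (Fin d ⊕ P) k) ∈
      Ideal.span ((fun s => (X (Sum.inl s) : MvPolynomial (Fin d ⊕ P) k)) '' (Z : Set (Fin d))) :=
    Ideal.subset_span ⟨i, hi, rfl⟩
  exact Ideal.mul_mem_right _ _ (Ideal.pow_mem_of_mem _ hX _ (Nat.pos_of_ne_zero he))

/-- `θ` maps the face ideal into the variable ideal `⟨x_s : s ∈ Z⟩` (positive pure powers, every mixed
generator meets `Z`). [OURS · L1 W4.5c] -/
theorem theta_mem_span_X_of_mem_faceIdeal (hpw : ∀ s, 0 < D.pw s)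
    (hmix : ∀ j : Fin r, ∃ i ∈ Z, D.mx j i ≠ 0) {y : Ring k P D} (hy : y ∈ faceIdeal k P D Z) :
    theta y ∈ Ideal.span ((fun s => (X (Sum.inl s) : MvPolynomial (Fin d ⊕ P) k)) '' (Z : Set (Fin d))) := by
  have h : faceIdeal k P D Z ≤ (Ideal.span ((fun s => (X (Sum.inl s) : MvPolynomial (Fin d ⊕ P) k)) ''
      (Z : Set (Fin d)))).comap (theta (k := k) (P := P) (D := D)) := by
    rw [faceIdeal, Ideal.span_le]
    rintro _ (⟨s, hs, rfl⟩ | ⟨j, rfl⟩)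
    · rw [SetLike.mem_coe, Ideal.mem_comap]
      change theta (wordElem k P D (pureWord s)) ∈ _
      rw [wordElem, theta_mk, wordPoly_pureWord, presentation_X_inl_inl]
      have hX : (X (Sum.inl s) : MvPolynomial (Fin d ⊕ P) k) ∈
          Ideal.span ((fun s => (X (Sum.inl s) : MvPolynomial (Fin d ⊕ P) k)) '' (Z : Set (Fin d))) :=
        Ideal.subset_span ⟨s, hs, rfl⟩
      exact Ideal.pow_mem_of_mem _ hX _ (hpw s)
    · rw [SetLike.mem_coe, Ideal.mem_comap]
      change theta (wordElem k P D (mixedWord j)) ∈ _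
      rw [wordElem, theta_mk, wordPoly_mixedWord, presentation_X_inr]
      obtain ⟨i, hi, hne⟩ := hmix j
      exact xmon_mem_span_X k P Z hi hne
  exact h hy

/-- The face substitution kills `⟨x_s : s ∈ Z⟩`. [folklore] -/
theorem faceSubst_eq_zero_of_mem_span_X {g : MvPolynomial (Fin d ⊕ P) k}
    (hg : g ∈ Ideal.span ((fun s => (X (Sum.inl s) : MvPolynomial (Fin d ⊕ P) k)) '' (Z : Set (Fin d)))) :
    faceSubst k P Z g = 0 := by
  have h : Ideal.span ((fun s => (X (Sum.inl s) : MvPolynomial (Fin d ⊕ P) k)) '' (Z : Set (Fin d))) ≤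
      RingHom.ker (faceSubst k P Z).toRingHom := by
    rw [Ideal.span_le]
    rintro _ ⟨s, hs, rfl⟩
    rw [SetLike.mem_coe, RingHom.mem_ker]
    change faceSubst k P Z (X (Sum.inl s)) = 0
    simp [faceSubst, Finset.mem_coe.mp hs]
  exact h hg

/-- The face substitution fixes the presentation of a polynomial in the surviving symbols.
[OURS · L1 W4.5c] -/
theorem faceSubst_presentation_rename_surv (G : MvPolynomial (Surv P Z r) k) :
    faceSubst k P Z (presentation k P D (rename Subtype.val G)) =
      presentation k P D (rename Subtype.val G) := by
  have key : ((faceSubst k P Z).comp (presentation k P D)).comp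
      (rename (Subtype.val : Surv P Z r → (Fin d ⊕ P) ⊕ Fin r)) =
      (presentation k P D).comp (rename (Subtype.val : Surv P Z r → (Fin d ⊕ P) ⊕ Fin r)) := by
    refine MvPolynomial.algHom_ext fun τ => ?_
    obtain ⟨v, hv, hvZ⟩ := τ.2
    simp only [AlgHom.comp_apply, rename_X, hv]
    rcases v with s | p
    · have hs : s ∉ Z := hvZ s rfl
      rw [presentation_X_inl_inl, map_pow]
      simp [faceSubst, hs]
    · rw [presentation_X_inl_inr]
      simp [faceSubst]
  have := AlgHom.congr_fun key G
  simpa only [AlgHom.comp_apply] using this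

/-- The classes of the non-surviving symbols (pure symbols of `Z`, mixed symbols) generate the face
ideal. [OURS · L1 W4.5c] -/
theorem map_mk_span_X_compl_surv :
    (Ideal.span (X '' (Set.range (Subtype.val : Surv P Z r → (Fin d ⊕ P) ⊕ Fin r))ᶜ :
        Set (MvPolynomial ((Fin d ⊕ P) ⊕ Fin r) k))).map
      (Ideal.Quotient.mk (RingHom.ker (presentation k P D))) = faceIdeal k P D Z := by
  rw [Ideal.map_span, faceIdeal, compl_range_surv, Set.image_union, Set.image_union, ← Set.image_comp,
    ← Set.image_comp, ← Set.range_comp, ← Set.range_comp]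
  congr 2
  · refine Set.image_congr' fun s => ?_
    change Ideal.Quotient.mk _ (X (Sum.inl (Sum.inl s))) = wordElem k P D (pureWord s)
    rw [wordElem, wordPoly_pureWord]
  · refine congrArg Set.range (funext fun j => ?_)
    change Ideal.Quotient.mk _ (X (Sum.inr j)) = wordElem k P D (mixedWord j)
    rw [wordElem, wordPoly_mixedWord]

/-- **`θ⁻¹ ⟨x_s : s ∈ Z⟩ = faceIdeal Z`** (positive pure powers, every mixed generator meets `Z`):
split `F ∈ k[Y]` as `(F − F|surv) + F|surv` (`ConeVertex.sub_rename_killCompl_mem_span`); the first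
class lies in the face ideal, and if `θ [F] ∈ ⟨x_Z⟩` then the presentation of `F|surv` lies in
`⟨x_Z⟩` and is fixed by the face substitution, hence vanishes. [OURS · L1 W4.5c] -/
theorem comap_theta_span_X_eq_faceIdeal (hpw : ∀ s, 0 < D.pw s)
    (hmix : ∀ j : Fin r, ∃ i ∈ Z, D.mx j i ≠ 0) :
    (Ideal.span ((fun s => (X (Sum.inl s) : MvPolynomial (Fin d ⊕ P) k)) '' (Z : Set (Fin d)))).comap
      (theta (k := k) (P := P) (D := D)) = faceIdeal k P D Z := by
  classical
  refine le_antisymm (fun y hy => ?_)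
    (fun y hy => (Ideal.mem_comap.mpr (theta_mem_span_X_of_mem_faceIdeal k P D Z hpw hmix hy)))
  obtain ⟨F, rfl⟩ := Ideal.Quotient.mk_surjective y
  rw [Ideal.mem_comap, theta_mk] at hy
  have hf : Function.Injective (Subtype.val : Surv P Z r → (Fin d ⊕ P) ⊕ Fin r) :=
    Subtype.val_injective
  have hdiff := ConeVertex.sub_rename_killCompl_mem_span (R := k) hf F
  have h1 : (Ideal.Quotient.mk (RingHom.ker (presentation k P D)) (F - rename Subtype.val (killCompl hf F)) :
      Ring k P D) ∈ faceIdeal k P D Z := by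
    rw [← map_mk_span_X_compl_surv]
    exact Ideal.mem_map_of_mem _ hdiff
  have h2 : presentation k P D (rename Subtype.val (killCompl hf F)) ∈
      Ideal.span ((fun s => (X (Sum.inl s) : MvPolynomial (Fin d ⊕ P) k)) '' (Z : Set (Fin d))) := by
    have h3 := theta_mem_span_X_of_mem_faceIdeal k P D Z hpw hmix h1
    rw [theta_mk, map_sub] at h3
    have := Ideal.sub_mem _ hy h3
    rwa [sub_sub_cancel] at this
  have h4 : presentation k P D (rename Subtype.val (killCompl hf F)) = 0 := by
    rw [← faceSubst_presentation_rename_surv k P D Z]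
    exact faceSubst_eq_zero_of_mem_span_X k P Z h2
  have h5 : (Ideal.Quotient.mk (RingHom.ker (presentation k P D)) (rename Subtype.val (killCompl hf F)) :
      Ring k P D) = 0 :=
    Ideal.Quotient.eq_zero_iff_mem.mpr h4
  have e : (Ideal.Quotient.mk (RingHom.ker (presentation k P D)) F : Ring k P D) =
      Ideal.Quotient.mk _ (F - rename Subtype.val (killCompl hf F)) +
        Ideal.Quotient.mk _ (rename Subtype.val (killCompl hf F)) := by
    rw [← map_add, sub_add_cancel]
  rw [e, h5, add_zero]
  exact h1

end Summit.ResolutionOfSingularities.ResolutionOfSingularities.Theorems.WildQuotientResolution.ToricChart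

end
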